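import Mathlib
import HarnessLib

/-!
# The `p`-adic Gen-3 parameter record `PadicG3Par` (WP-M3.R, cell abc-stewartyu, rung A1.M3)

Support file (plain definitions and elementary theorems; no named facts). The RECORD of the
`p`-adic Matveev–Nesterenko engine (`GenThreeEngineOdd/Two` of route `PadicPrimesKummerThird`):
Nesterenko 2003's parameter family (3.23)/(4.3)–(4.5)/(5.6)–(5.8) transplanted to `ℚ_p` with the
two `p`-adic substitutions of the cell's K-M3.1 page (HOME/p1/K-M3-1-padic-ledger.md §1, §4;
p2's HOME/p2/K-M3-1-ledger-p2.md):
* the archimedean gain `log(R/r) ≈ n + 3` per zero is replaced by `G = (m + θ₀)·log p`, where the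
  exponent box is restricted to ONE class modulo `p^{m+1}` of the `p`-adic exponent form (Yu 1999's
  device, the `p`-adic twin of Matveev's slab) and `m = ⌈c_G (n+1)/log p − θ₀⌉₊`, so that
  `G ≥ c_G (n+1)` for EVERY `p` at the class-count cost `K = p^m · K₀ ≤ K₀ · p · e^{c_G (n+1)}`
  (`K₀` = the twist classes of the landed `PadicTwistSiegel.siegel_class`);
* heights stay PLAIN (`A j ≥ log 2`, no `(log p)`-units), the box is Matveev's UNSHARED box
  `|λⱼ| ≤ L/(2Aⱼ)`, the multiplicity is `M = c_M (n+1) L` with an ABSOLUTE `c_M`, and the depth is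
  capped at `Ŝ = n + 24 + ⌊log₂ N_q⌋` where the END is the tree theorem `Nesterenko2003_prop51_holds`.
The record is Setup-independent (it sees only `n, p, A, Amax, W, N_q, K₀, θ₀`), exactly as
`PadicW80ParL` is over `d`; the frame (`PadicG3Setup`, p2) instantiates it. This file: the structure,
the closed forms, and the first elementary bounds; the budget lines (B1)–(B7) of the K-M3.1 page
follow in `PadicG3ParA/B`.

## References
* [Nesterenko2003] Yu. V. Nesterenko, *Linear forms in logarithms of rational numbers*, LNM 1819
  (2003) 53–106 — (3.23), (4.3)–(4.5), (5.6)–(5.8).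
* [Yu1999] K. Yu, *p-adic logarithmic forms and group varieties II*, Acta Arith. 89 (1999) —
  p. 340 and §10 (10.13)–(10.19) (the congruence-class device), §2 (2.2)–(2.7).
* [Yu2013] K. Yu, *p-adic logarithmic forms and a problem of Erdős*, Acta Math. 211 (2013) —
  (1.2), (2.1), (3.1)–(3.9) for orientation (the `C₁` ledger; this record is the `C₂` regime).
-/

noncomputable section

open Finset Real

namespace Summit.ABC.StewartYu

/-- **The data of the `p`-adic Gen-3 record.** `n ≥ 1` generators of plain heights
`log 2 ≤ A j ≤ Amax`, the prime `p`, the coefficient logarithm `W ≥ 1` (`W ≥ log max |bⱼ|`), the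
`q`-saturation index `N_q ≥ 1` of the generators (`= 1` under the route's Kummer hypothesis), the
number `K₀ ≥ 1` of twist classes (`≤ p`), and the supernormality exponent `θ₀ ∈ (0, 2]` of the
frame's twisted units (`(p−2)/(p−1)`-type at `p ≥ 5`, the landed `1/2` also admissible; `≤ 2` at
`p = 2`). [cite: Nesterenko2003, §2 (2.3)] [cite: Yu2013, (1.2), (2.1)] -/
structure PadicG3Par (n : ℕ) where
  /-- the prime -/
  p : ℕ
  /-- plain heights of the generators -/
  A : Fin n → ℝ
  /-- a common bound of the heights (enters only logarithms) -/
  Amax : ℝ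
  /-- the coefficient logarithm `W ≥ log max(3, |bⱼ|)` -/
  W : ℝ
  /-- the `q`-saturation index of the generators -/
  Nq : ℕ
  /-- the number of twist classes -/
  K₀ : ℕ
  /-- the supernormality exponent of the twisted units -/
  θ₀ : ℝ
  hn : 1 ≤ n
  hp : 2 ≤ p
  hA : ∀ j, Real.log 2 ≤ A j
  hAmax : ∀ j, A j ≤ Amax
  hAmax1 : 1 ≤ Amax
  hW : 1 ≤ W
  hNq : 1 ≤ Nq
  hK₀ : 1 ≤ K₀
  hK₀p : K₀ ≤ p
  hθ₀ : 0 < θ₀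
  hθ₀2 : θ₀ ≤ 2

namespace PadicG3Par

variable {n : ℕ} (P : PadicG3Par n)

/-! ### Absolute constants (v1 shares of the K-M3.1 page §4; unoptimised) -/

/-- gain constant `c_G = 8`: `G ≥ c_G (n+1)`. [folklore] -/
def cG : ℝ := 8

/-- multiplicity constant `c_M = 16`: `M = c_M (n+1) L`. [folklore] -/
def cM : ℕ := 16

/-- Siegel base `C_b = 2e·c_M` per coordinate. [folklore] -/
def Cb : ℝ := 2 * Real.exp 1 * cM

/-! ### The closed forms (K-M3.1 page §1) -/

/-- `Ω = ∏ A j`. [cite: Nesterenko2003, (2.3)] -/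
def Ω : ℝ := ∏ j, P.A j

/-- the one logarithm `W⁺ = W + log p + log(2 Amax)` of the engine text. [folklore] -/
def Wp : ℝ := P.W + Real.log P.p + Real.log (2 * P.Amax)

/-- `m = ⌈c_G (n+1)/log p − θ₀⌉₊`, the depth of the `p`-adic class device. [cite: Yu1999, §2 (2.4)] -/
def m : ℕ := ⌈cG * (n + 1) / Real.log P.p - P.θ₀⌉₊

/-- `θ_m = m + θ₀`, the Schwarz radius exponent (`p^{θ_m}`). [cite: Yu1999, §2 (2.5)] -/
def θm : ℝ := P.m + P.θ₀

/-- the gain per zero `G = θ_m · log p` (height units). [cite: Yu1999, p. 339] -/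
def G : ℝ := P.θm * Real.log P.p

/-- the total class count `K = p^m · K₀` dividing the box. [cite: Yu1999, (10.16)] -/
def K : ℕ := P.p ^ P.m * P.K₀

/-- the depth `Ŝ = n + 24 + ⌊log₂ N_q⌋` of the descent (END = zero estimate). [cite: Nesterenko2003, (3.24)] -/
def Sdepth : ℕ := n + 24 + Nat.log 2 P.Nq

/-- the `X`-free logarithmic load of the `Y₀`-line: `G + 2 log p + (Ŝ+n+1) log 2 + log(n+1) + 8`. [folklore] -/
def yload : ℝ := P.G + 2 * Real.log P.p + (P.Sdepth + n + 1) * Real.log 2 + Real.log (n + 1) + 8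

/-- the Matveev box scale
`L = max(⌈24 · C_bⁿ · Ω · K · yload / G⌉₊, 2^{n+25} N_q, ⌈2 Amax⌉₊)` (W-free). [cite: Nesterenko2003, §3.5] -/
def L : ℕ := max (max ⌈24 * Cb ^ n * P.Ω * P.K * P.yload / P.G⌉₊ (2 ^ (n + 25) * P.Nq)) ⌈2 * P.Amax⌉₊

/-- the total multiplicity `M = c_M (n+1) L`. [cite: Nesterenko2003, Prop 3.9] -/
def M : ℕ := cM * (n + 1) * P.L

/-- the size logarithm `W_L = log(e (1 + 2 e^W L))` of the directional Feldman weights. [cite: Nesterenko2003, (3.37)] -/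
def WL : ℝ := Real.log (Real.exp 1 * (1 + 2 * Real.exp P.W * P.L))

/-- the number of points at level `0`:
`X = max(⌈64 (n+1) W_L / G⌉₊, ⌈(3/2)(n+1) L/(C_bⁿ Ω K)⌉₊)`. [cite: Nesterenko2003, Prop 3.9] -/
def X : ℕ := max ⌈64 * (n + 1) * P.WL / P.G⌉₊ ⌈(3 / 2) * (n + 1) * P.L / (Cb ^ n * P.Ω * P.K)⌉₊

/-- the `Y₀`-degree `L₀ = ⌈6 X C_bⁿ Ω K⌉₊` (Siegel-driven). [cite: Nesterenko2003, (3.23)] -/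
def L₀ : ℕ := ⌈6 * P.X * Cb ^ n * P.Ω * P.K⌉₊

/-- the Feldman block `H = max(1, ⌊G X/(64 (n+1))⌋₊)`. [cite: Nesterenko2003, (3.23)] -/
def H : ℕ := max 1 ⌊P.G * P.X / (64 * (n + 1))⌋₊

/-- the per-stage decrement `T_s = ⌊2^{−s−1} M/(n+1)⌋ = 8L/2^s`. [cite: Nesterenko2003, (4.3)] -/
def T (s : ℕ) : ℕ := 8 * P.L / 2 ^ s

/-- the base number of points at level `s`: `X_s = ⌊X M/((4n+4)(T_s+1))⌋ = 4XL/(T_s+1)`. [cite: Nesterenko2003, (4.3)] -/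
def Xs (s : ℕ) : ℕ := 4 * P.X * P.L / (P.T s + 1)

/-- the order available at stage `(s, ν)`: `M((n+2)^{−3} + 2^{−s−1}(2 − ν/(n+1)))`. [cite: Nesterenko2003, (4.5)] -/
def Mord (s ν : ℕ) : ℕ := P.M / (n + 2) ^ 3 + P.T s * (2 * (n + 1) - ν)

/-- the final `Y₀`-degree bound `D₀ = L₀ + 1` for `Nesterenko2003_prop51`. [cite: Nesterenko2003, §5.2] -/
def D₀ : ℕ := P.L₀ + 1

/-- the final degrees `D j = ⌊2^{−Ŝ} N_q L / A j⌋₊ + 1`. [cite: Nesterenko2003, §5.2] -/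
def D (j : Fin n) : ℕ := ⌊(P.Nq : ℝ) * P.L / (2 ^ P.Sdepth * P.A j)⌋₊ + 1

/-- the final point range `X′ = ⌊2ⁿ X_Ŝ/(n+1)⌋`. [cite: Nesterenko2003, §5.2] -/
def Xfin : ℕ := 2 ^ n * P.Xs P.Sdepth / (n + 1)

/-- Nesterenko's `S₀ = ⌊M/(n+2)⁴⌋` (order share at the END). [cite: Nesterenko2003, (5.8)] -/
def S₀N : ℕ := P.M / (n + 2) ^ 4

/-- the exit-C scale `κ_E = 2^{n+24}/L`. [cite: Nesterenko2003, §5.2] -/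
def κE : ℝ := 2 ^ (n + 24) / P.L

/-- the assumed order `U₀ = ⌈(9/2)·2ⁿ·θ_m·X·L⌉₊ + 1` (in `ord_p` units; `U₀ log p` is the height budget). [cite: Nesterenko2003, (2.14)] -/
def U₀ : ℕ := ⌈(9 / 2) * 2 ^ n * P.θm * P.X * P.L⌉₊ + 1

/-! ### Elementary facts about the data -/

/-- `2 ≤ p` (real). [folklore] -/
theorem two_le_p : (2 : ℝ) ≤ P.p := by exact_mod_cast P.hp

/-- `0 < log p`. [folklore] -/
theorem log_p_pos : 0 < Real.log P.p := Real.log_pos (by linarith [P.two_le_p])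

/-- `log 2 ≤ log p`. [folklore] -/
theorem log_two_le_log_p : Real.log 2 ≤ Real.log P.p :=
  Real.log_le_log (by norm_num) P.two_le_p

/-- `0 < A j` (as `A j ≥ log 2 > 0.69`). [folklore] -/
theorem A_pos (j : Fin n) : 0 < P.A j := by
  have := P.hA j; have := Real.log_two_gt_d9; linarith

/-- `0 < Ω`. [folklore] -/
theorem Ω_pos : 0 < P.Ω := Finset.prod_pos fun j _ => P.A_pos j

/-- `(log 2)ⁿ ≤ Ω`. [folklore] -/
theorem log_two_pow_le_Ω : Real.log 2 ^ n ≤ P.Ω := by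
  unfold Ω
  calc Real.log 2 ^ n = ∏ _j : Fin n, Real.log 2 := by simp
    _ ≤ ∏ j, P.A j := Finset.prod_le_prod (fun _ _ => by positivity) fun j _ => P.hA j

/-- `1 ≤ W⁺`. [folklore] -/
theorem one_le_Wp : 1 ≤ P.Wp := by
  unfold Wp
  have h1 := P.hW
  have h2 : 0 ≤ Real.log P.p := P.log_p_pos.le
  have h3 : 0 ≤ Real.log (2 * P.Amax) := Real.log_nonneg (by linarith [P.hAmax1])
  linarith

/-! ### The device: `m`, `θ_m`, `G`, `K` -/

/-- `0 < c_G`. [folklore] -/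
theorem cG_pos : (0 : ℝ) < cG := by norm_num [cG]

/-- `c_G (n+1)/log p − θ₀ ≤ m`. [folklore] -/
theorem m_ge : cG * (n + 1) / Real.log P.p - P.θ₀ ≤ P.m := Nat.le_ceil _

/-- `m ≤ c_G (n+1)/log p + 1` (the ceiling and `θ₀ > 0`). [folklore] -/
theorem m_le : (P.m : ℝ) ≤ cG * (n + 1) / Real.log P.p + 1 := by
  unfold m
  have hx : 0 ≤ cG * (n + 1) / Real.log P.p := by
    have := P.log_p_pos; have := cG_pos; positivity
  by_cases h : cG * (n + 1) / Real.log P.p - P.θ₀ ≤ 0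
  · rw [Nat.ceil_eq_zero.mpr h]; push_cast; linarith
  · push Not at h
    have := Nat.ceil_lt_add_one h.le
    have hθ := P.hθ₀
    linarith

/-- `θ₀ ≤ θ_m`. [folklore] -/
theorem θ₀_le_θm : P.θ₀ ≤ P.θm := by
  unfold θm
  have h : (0 : ℝ) ≤ P.m := by positivity
  linarith

/-- `0 < θ_m`. [folklore] -/
theorem θm_pos : 0 < P.θm := lt_of_lt_of_le P.hθ₀ P.θ₀_le_θm

/-- **`G ≥ c_G (n+1)`** — the gain per zero dominates the number of inner stages, for EVERY `p`.
[cite: Yu1999, p. 339] -/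
theorem cG_mul_le_G : cG * (n + 1) ≤ P.G := by
  unfold G θm
  have hlog := P.log_p_pos
  have hm := P.m_ge
  have h1 : cG * (n + 1) / Real.log P.p ≤ P.m + P.θ₀ := by linarith
  rw [div_le_iff₀ hlog] at h1
  linarith

/-- `8 ≤ G` (since `n + 1 ≥ 1`). [folklore] -/
theorem eight_le_G : 8 ≤ P.G := by
  have h := P.cG_mul_le_G
  have h0 : (0 : ℝ) ≤ n := by positivity
  unfold cG at h; nlinarith

/-- `θ₀ log p ≤ G`. [folklore] -/
theorem θ₀_log_le_G : P.θ₀ * Real.log P.p ≤ P.G := by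
  unfold G; exact mul_le_mul_of_nonneg_right P.θ₀_le_θm P.log_p_pos.le

/-- `G ≤ c_G (n+1) + (θ₀ + 1) log p` (no overshoot beyond one unit of `log p`). [folklore] -/
theorem G_le : P.G ≤ cG * (n + 1) + (P.θ₀ + 1) * Real.log P.p := by
  unfold G θm
  have hlog := P.log_p_pos
  have hm := P.m_le
  have : (P.m : ℝ) * Real.log P.p ≤ cG * (n + 1) + Real.log P.p := by
    have := mul_le_mul_of_nonneg_right hm hlog.le
    rwa [add_mul, one_mul, div_mul_cancel₀ _ hlog.ne'] at this
  nlinarith [P.hθ₀]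

/-- `1 ≤ K`. [folklore] -/
theorem one_le_K : 1 ≤ P.K := by
  unfold K
  have : 1 ≤ P.p ^ P.m := Nat.one_le_pow _ _ (by have := P.hp; omega)
  have := P.hK₀
  nlinarith

/-- `0 < K` (real). [folklore] -/
theorem K_pos : (0 : ℝ) < P.K := by exact_mod_cast P.one_le_K

/-- **`p^m ≤ p · e^{c_G (n+1)}`**: the class device costs `e^{gain}`, as Matveev's slab does.
[cite: Yu1999, (10.16)] -/
theorem pow_m_le : (P.p : ℝ) ^ P.m ≤ P.p * Real.exp (cG * (n + 1)) := by
  have hp : (1 : ℝ) < P.p := by linarith [P.two_le_p]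
  have hlog := P.log_p_pos
  have hm := P.m_le
  have h1 : (P.p : ℝ) ^ P.m = Real.exp (P.m * Real.log P.p) := by
    rw [← Real.rpow_natCast, Real.rpow_def_of_pos (by linarith), mul_comm]
  have h2 : (P.m : ℝ) * Real.log P.p ≤ cG * (n + 1) + Real.log P.p := by
    have := mul_le_mul_of_nonneg_right hm hlog.le
    rwa [add_mul, one_mul, div_mul_cancel₀ _ hlog.ne'] at this
  rw [h1]
  calc Real.exp (P.m * Real.log P.p) ≤ Real.exp (cG * (n + 1) + Real.log P.p) :=
        Real.exp_le_exp.mpr h2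
    _ = P.p * Real.exp (cG * (n + 1)) := by
        rw [Real.exp_add, Real.exp_log (by linarith), mul_comm]

/-- **`K ≤ K₀ · p · e^{c_G (n+1)} ≤ p² e^{c_G (n+1)}`** (and `K₀ ≤ p`): ONE factor `p` from the twist
classes, the device's `p^m` being `e^{O(n)}` up to one `p` that §0 (V4) of the K-M3.1 page absorbs
(`m ≥ 1 ⇒ log p < c_G (n+1)/θ₀`). [cite: Yu1999, (10.16)] -/
theorem K_le : (P.K : ℝ) ≤ P.K₀ * (P.p * Real.exp (cG * (n + 1))) := by
  unfold K; push_cast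
  have := P.pow_m_le
  have hK : (0 : ℝ) ≤ P.K₀ := by positivity
  nlinarith

/-- If the device is active (`m ≥ 1`) then `p` is small: `θ₀ log p < c_G (n+1)`. [folklore] -/
theorem θ₀_log_lt_of_m_pos (h : 1 ≤ P.m) : P.θ₀ * Real.log P.p < cG * (n + 1) := by
  have hlog := P.log_p_pos
  by_contra hc
  push Not at hc
  have hle : cG * (n + 1) / Real.log P.p - P.θ₀ ≤ 0 := by
    rw [sub_nonpos, div_le_iff₀ hlog]; linarith
  have : P.m = 0 := Nat.ceil_eq_zero.mpr hle
  omega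

/-! ### `Ŝ`, `L`, `M` -/

/-- `2^{Ŝ} ≤ 2^{n+24} · N_q` (so that `L/Aⱼ ≤ 2^{n+24} Dⱼ`, exit-C's scale). [cite: Nesterenko2003, (5.6)] -/
theorem two_pow_Sdepth_le : 2 ^ P.Sdepth ≤ 2 ^ (n + 24) * P.Nq := by
  unfold Sdepth
  rw [pow_add]
  exact Nat.mul_le_mul_left _ (Nat.pow_log_le_self 2 (by have := P.hNq; omega))

/-- `N_q < 2^{Ŝ − n − 23}`, i.e. `2^{n+24} N_q < 2 · 2^{Ŝ}`. [folklore] -/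
theorem Nq_lt_two_pow : 2 ^ (n + 24) * P.Nq < 2 * 2 ^ P.Sdepth := by
  unfold Sdepth
  have h := Nat.lt_pow_succ_log_self (b := 2) (by norm_num) P.Nq
  calc 2 ^ (n + 24) * P.Nq < 2 ^ (n + 24) * 2 ^ (Nat.log 2 P.Nq + 1) :=
        Nat.mul_lt_mul_of_pos_left h (by positivity)
    _ = 2 * 2 ^ (n + 24 + Nat.log 2 P.Nq) := by ring

/-- `2^{n+25} N_q ≤ L`. [cite: Nesterenko2003, (5.6)] -/
theorem two_pow_mul_Nq_le_L : 2 ^ (n + 25) * P.Nq ≤ P.L := by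
  unfold L; exact le_trans (le_max_right _ _) (le_max_left _ _)

/-- `2^{n+24} ≤ L` (Nesterenko's `N L ≥ 2^S`). [cite: Nesterenko2003, (5.6)] -/
theorem two_pow_le_L : 2 ^ (n + 24) ≤ P.L := by
  have h := P.two_pow_mul_Nq_le_L
  have h1 : 2 ^ (n + 24) ≤ 2 ^ (n + 25) * P.Nq := by
    calc 2 ^ (n + 24) ≤ 2 ^ (n + 25) := Nat.pow_le_pow_right (by norm_num) (by omega)
      _ ≤ 2 ^ (n + 25) * P.Nq := Nat.le_mul_of_pos_right _ (by have := P.hNq; omega)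
  exact h1.trans h

/-- `2 · 2^{Ŝ} ≤ L` (one spare halving: `T_Ŝ ≥ 1` below). [folklore] -/
theorem two_mul_two_pow_Sdepth_le_L : 2 * 2 ^ P.Sdepth ≤ P.L := by
  have h1 := P.two_pow_Sdepth_le
  have h2 := P.two_pow_mul_Nq_le_L
  calc 2 * 2 ^ P.Sdepth ≤ 2 * (2 ^ (n + 24) * P.Nq) := by omega
    _ = 2 ^ (n + 25) * P.Nq := by ring
    _ ≤ P.L := h2

/-- `2 Amax ≤ L` (every box side `L/(2Aⱼ) ≥ 1`). [folklore] -/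
theorem two_Amax_le_L : 2 * P.Amax ≤ P.L := by
  have h : (⌈2 * P.Amax⌉₊ : ℝ) ≤ P.L := by unfold L; exact_mod_cast le_max_right _ _
  exact (Nat.le_ceil _).trans h

/-- the Siegel/`Y₀` term of `L`: `24 C_bⁿ Ω K · yload/G ≤ L`. [folklore] -/
theorem main_le_L : 24 * Cb ^ n * P.Ω * P.K * P.yload / P.G ≤ P.L := by
  have h : (⌈24 * Cb ^ n * P.Ω * P.K * P.yload / P.G⌉₊ : ℝ) ≤ P.L := by
    unfold L; exact_mod_cast le_trans (le_max_left _ _) (le_max_left _ _)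
  exact (Nat.le_ceil _).trans h

/-- `1 ≤ L` (real), indeed `2^{24} ≤ L`. [folklore] -/
theorem one_le_L : (1 : ℝ) ≤ P.L := by
  have h := P.two_pow_le_L
  have : 1 ≤ P.L := le_trans (Nat.one_le_two_pow) h
  exact_mod_cast this

/-- `M = 16 (n+1) L`. [cite: Nesterenko2003, Prop 3.9] -/
theorem M_eq : P.M = 16 * (n + 1) * P.L := rfl

end PadicG3Par

end Summit.ABC.StewartYu
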